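import Summits.CriticalPhenomena.PercolationContinuityZ3.Theorems.Transplant.SkelPhiNegReachReadB
import HarnessLib

/-!
# N1 (the `{±1}` node), (C) column file (C-S9c): ONE-SIDED AND DRIFTING READING BOUNDS for the long boxes of the corridor band — on top of the
# division-free criteria of (C-S9a): **`readLo0_of_budget` / `readHi0_of_budget`** (axis `0`, a box with `lo₀ ≥ −B` resp. `hi₀ ≤ B` and `|lo₁|, |hi₁| ≤ X₁`
# reads `≥ −(m·r₀) + 1` resp. `≤ m·r₀ − 1` as soon as `Δ·B + |v_α|·U·(X₁+1) + 3Δ·n ≤ 40·m·Δ·n`), **`readLo1_of_budget` / `readHi1_of_budget`** (axis `1`: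
# `U·B + 2Δ ≤ 40·m·Δ`, resp. `U·(B+1) + 2Δ ≤ 40·m·Δ`), and the across reading of a DRIFTING box **`readAcross0_drift`**: `lo₀, hi₀ = v_α·t ∓ B`, the along
# interval within `c ± ρ` with anchor mismatch `|Δ·t − U·c| ≤ E` reads inside `[−Y + 1, Y − 1]` on axis `0` as soon as
# `r₀·(Δ·B + |v_α|·U·(ρ+1) + |v_α|·E) + 40Δ·n + r₀·n ≤ 40·Δ·n·Y` — the form of the y′-band's regions and last core, whose raw `α`-extent is `800·|v_α|`
# but whose lattice extent is small.

builds on p205010 (kernel theorem, internal audit signed; external expert review pending) — nothing in this file uses p205010; nothing here is a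
claim about the open node `SamePDropOfSkeletonNeg`.
Lane `prim-bschramm`, seat `prim-bschramm-p5` (gen 9; (C) lineage); helper file (`--supports stmt-CriticalPhenomena-4575`).
[cite: KozmaNitzan2024, §4 Lemma 12 (pp. 23–25), p. 26 (Q_v, M_v, H_{v,x})] [cite: MartineauTassion2017, §4.1]
-/

noncomputable section

namespace Summit.CriticalPhenomena.PercolationContinuityZ3.Theorems

namespace Transplant

namespace Skelφ

open Literature.Probability.Percolation Literature.Probability.LatticeModels
open Literature.Probability.Percolation.KozmaNitzan.Cells (oth oth_ne sgOf sgOf_sign eq_oth_of_ne)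
open TwoAxis.Para (modulus)
open ChainPlanar ChainPara

section Budget

variable {A : ℤ} {n : ℕ} {h vα vβ c₀' c₁' D : ℤ} {P : PCells2}
  (hn : 1 ≤ n) (hA : 0 < A) (hD : 0 < D) (hm : 0 < modulus n h vα vβ) (hc₀ : 0 < c₀')
  (hsc0 : c₀' * A * (40 * modulus n h vα vβ) = (P.r 0 : ℤ) * D) (hsc1 : c₁' * A * (40 * modulus n h vα vβ) = (P.r 1 : ℤ) * D)

/-! ## §1 One-sided budgets, axis `0` -/

include hn hA hD hm hc₀ hsc0 in
/-- **Axis-`0` lower budget**: `lo₀ ≥ −B`, `|lo₁|, |hi₁| ≤ X₁`, `Δ·B + |v_α|·U·(X₁+1) + 3Δ·n ≤ 40·m·Δ·n ⟹ −(m·r₀) + 1 ≤ rdLo₀`. [this work] -/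
theorem readLo0_of_budget {lo hi : Site 2} {B X₁ m : ℤ} (h0 : -B ≤ lo 0) (h1l : |lo 1| ≤ X₁) (h1h : |hi 1| ≤ X₁)
    (hbud : modulus n h vα vβ * B + |vα| * ((shearUnit n h : ℤ) * (X₁ + 1)) + 3 * modulus n h vα vβ * n ≤ 40 * m * modulus n h vα vβ * n) :
    -(m * (P.r 0 : ℤ)) + 1 ≤ rdLo A n h vα vβ c₀' c₁' D lo hi 0 := by
  have hr0 : (20 : ℤ) ≤ P.r 0 := by have := P.twenty_mul_s_le_r 0; have := P.hs 0; omega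
  have hΔ : (0 : ℤ) < modulus n h vα vβ := hm
  have hn1 : (1 : ℤ) ≤ n := by exact_mod_cast hn
  set C := |vα| * ((shearUnit n h : ℤ) * (X₁ + 1)) with hC
  have hmax : max (vα * ((shearUnit n h : ℤ) * lo 1)) (vα * ((shearUnit n h : ℤ) * hi 1 + shearUnit n h - 1)) ≤ C :=
    max_le ((le_abs_self _).trans (mixed_le hn hm h1l).1) ((le_abs_self _).trans (mixed_le hn hm h1h).2)
  refine rdLo_zero_ge hn hA hD hm hc₀ hsc0 ?_
  have h1 : (P.r 0 : ℤ) * (modulus n h vα vβ * (-B) - C) ≤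
      (P.r 0 : ℤ) * (modulus n h vα vβ * lo 0 - max (vα * ((shearUnit n h : ℤ) * lo 1)) (vα * ((shearUnit n h : ℤ) * hi 1 + shearUnit n h - 1))) :=
    mul_le_mul_of_nonneg_left (by have := mul_le_mul_of_nonneg_left h0 hΔ.le; linarith) (by linarith)
  have h2 : (P.r 0 : ℤ) * (modulus n h vα vβ * B + C + 3 * modulus n h vα vβ * n) ≤ (P.r 0 : ℤ) * (40 * m * modulus n h vα vβ * n) :=
    mul_le_mul_of_nonneg_left hbud (by linarith)
  have h3 : 40 * modulus n h vα vβ * n ≤ 2 * modulus n h vα vβ * n * (P.r 0 : ℤ) := by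
    have := mul_le_mul_of_nonneg_left hr0 (show (0:ℤ) ≤ modulus n h vα vβ * n by positivity); linarith
  have h4 : (P.r 0 : ℤ) * n ≤ modulus n h vα vβ * n * (P.r 0 : ℤ) := by
    have := mul_le_mul_of_nonneg_left (show (1:ℤ) ≤ modulus n h vα vβ from hm) (show (0:ℤ) ≤ n * (P.r 0 : ℤ) by positivity); linarith
  have h5 : (0 : ℤ) ≤ modulus n h vα vβ * n * (P.r 0 : ℤ) := by positivity
  linarith

include hn hD hm hc₀ hsc0 in
/-- **Axis-`0` upper budget**: `hi₀ ≤ B`, `|lo₁|, |hi₁| ≤ X₁`, `Δ·B + |v_α|·U·(X₁+1) + 3Δ·n ≤ 40·m·Δ·n ⟹ rdHi₀ ≤ m·r₀ − 1`. [this work] -/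
theorem readHi0_of_budget {lo hi : Site 2} {B X₁ m : ℤ} (h0 : hi 0 ≤ B) (h1l : |lo 1| ≤ X₁) (h1h : |hi 1| ≤ X₁)
    (hbud : modulus n h vα vβ * B + |vα| * ((shearUnit n h : ℤ) * (X₁ + 1)) + 3 * modulus n h vα vβ * n ≤ 40 * m * modulus n h vα vβ * n) :
    rdHi A n h vα vβ c₀' c₁' D lo hi 0 ≤ m * (P.r 0 : ℤ) - 1 := by
  have hr0 : (20 : ℤ) ≤ P.r 0 := by have := P.twenty_mul_s_le_r 0; have := P.hs 0; omega
  have hΔ : (0 : ℤ) < modulus n h vα vβ := hm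
  have hn1 : (1 : ℤ) ≤ n := by exact_mod_cast hn
  set C := |vα| * ((shearUnit n h : ℤ) * (X₁ + 1)) with hC
  have hmin : -C ≤ min (vα * ((shearUnit n h : ℤ) * lo 1)) (vα * ((shearUnit n h : ℤ) * hi 1 + shearUnit n h - 1)) :=
    le_min ((neg_le_neg (mixed_le hn hm h1l).1).trans (neg_abs_le _)) ((neg_le_neg (mixed_le hn hm h1h).2).trans (neg_abs_le _))
  refine rdHi_zero_le hn hD hm hc₀ hsc0 ?_
  have h1 : (P.r 0 : ℤ) * (modulus n h vα vβ * hi 0 - min (vα * ((shearUnit n h : ℤ) * lo 1)) (vα * ((shearUnit n h : ℤ) * hi 1 + shearUnit n h - 1))) ≤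
      (P.r 0 : ℤ) * (modulus n h vα vβ * B + C) :=
    mul_le_mul_of_nonneg_left (by have := mul_le_mul_of_nonneg_left h0 hΔ.le; linarith) (by linarith)
  have h2 : (P.r 0 : ℤ) * (modulus n h vα vβ * B + C + 3 * modulus n h vα vβ * n) ≤ (P.r 0 : ℤ) * (40 * m * modulus n h vα vβ * n) :=
    mul_le_mul_of_nonneg_left hbud (by linarith)
  have h3 : 40 * modulus n h vα vβ * n < 3 * modulus n h vα vβ * n * (P.r 0 : ℤ) := by
    have := mul_le_mul_of_nonneg_left hr0 (show (0:ℤ) ≤ modulus n h vα vβ * n by positivity)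
    have : 0 < modulus n h vα vβ * n := by positivity
    linarith
  have h5 : (0 : ℤ) ≤ modulus n h vα vβ * n * (P.r 0 : ℤ) := by positivity
  linarith

/-! ## §2 One-sided budgets, axis `1` -/

include hD hm hsc1 in
/-- **Axis-`1` lower budget**: `lo₁ ≥ −B`, `U·B + 2Δ ≤ 40·m·Δ ⟹ −(m·r₁) + 1 ≤ rdLo₁`. [this work] -/
theorem readLo1_of_budget {lo hi : Site 2} {B m : ℤ} (h1 : -B ≤ lo 1)
    (hbud : (shearUnit n h : ℤ) * B + 2 * modulus n h vα vβ ≤ 40 * m * modulus n h vα vβ) :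
    -(m * (P.r 1 : ℤ)) + 1 ≤ rdLo A n h vα vβ c₀' c₁' D lo hi 1 := by
  have hr1 : (20 : ℤ) ≤ P.r 1 := by have := P.twenty_mul_s_le_r 1; have := P.hs 1; omega
  have hΔ : (0 : ℤ) < modulus n h vα vβ := hm
  have hU : (0 : ℤ) ≤ shearUnit n h := by positivity
  refine rdLo_one_ge hD hm hsc1 ?_
  have a1 : (P.r 1 : ℤ) * ((shearUnit n h : ℤ) * (-B)) ≤ (P.r 1 : ℤ) * ((shearUnit n h : ℤ) * lo 1) :=
    mul_le_mul_of_nonneg_left (mul_le_mul_of_nonneg_left h1 hU) (by linarith)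
  have a2 : (P.r 1 : ℤ) * ((shearUnit n h : ℤ) * B + 2 * modulus n h vα vβ) ≤ (P.r 1 : ℤ) * (40 * m * modulus n h vα vβ) :=
    mul_le_mul_of_nonneg_left hbud (by linarith)
  have a3 : 40 * modulus n h vα vβ ≤ 2 * modulus n h vα vβ * (P.r 1 : ℤ) := by
    have := mul_le_mul_of_nonneg_left hr1 hΔ.le; linarith
  linarith

include hD hm hsc1 in
/-- **Axis-`1` upper budget**: `hi₁ ≤ B`, `U·(B+1) + 2Δ ≤ 40·m·Δ ⟹ rdHi₁ ≤ m·r₁ − 1`. [this work] -/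
theorem readHi1_of_budget {lo hi : Site 2} {B m : ℤ} (h1 : hi 1 ≤ B)
    (hbud : (shearUnit n h : ℤ) * (B + 1) + 2 * modulus n h vα vβ ≤ 40 * m * modulus n h vα vβ) :
    rdHi A n h vα vβ c₀' c₁' D lo hi 1 ≤ m * (P.r 1 : ℤ) - 1 := by
  have hr1 : (20 : ℤ) ≤ P.r 1 := by have := P.twenty_mul_s_le_r 1; have := P.hs 1; omega
  have hΔ : (0 : ℤ) < modulus n h vα vβ := hm
  have hU : (0 : ℤ) ≤ shearUnit n h := by positivity
  refine rdHi_one_le hD hm hsc1 ?_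
  have a1 : (P.r 1 : ℤ) * ((shearUnit n h : ℤ) * hi 1 + shearUnit n h - 1) ≤ (P.r 1 : ℤ) * ((shearUnit n h : ℤ) * (B + 1) - 1) :=
    mul_le_mul_of_nonneg_left (by have := mul_le_mul_of_nonneg_left h1 hU; linarith) (by linarith)
  have a2 : (P.r 1 : ℤ) * ((shearUnit n h : ℤ) * (B + 1) + 2 * modulus n h vα vβ) ≤ (P.r 1 : ℤ) * (40 * m * modulus n h vα vβ) :=
    mul_le_mul_of_nonneg_left hbud (by linarith)
  have a3 : 40 * modulus n h vα vβ ≤ 2 * modulus n h vα vβ * (P.r 1 : ℤ) := by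
    have := mul_le_mul_of_nonneg_left hr1 hΔ.le; linarith
  have a4 : (0 : ℤ) < P.r 1 := by linarith
  linarith

/-! ## §3 The across reading of a drifting box -/

include hn hm in
/-- The mixed terms about an anchor: `max (v U lo₁, v (U hi₁ + U − 1)) ≤ v·U·c + |v|·U·(ρ + 1)` and the mirror bound for `min`, when
`|lo₁ − c|, |hi₁ − c| ≤ ρ`. [folklore] -/
theorem mixed_anchor {lo1 hi1 c ρ : ℤ} (hl : |lo1 - c| ≤ ρ) (hh : |hi1 - c| ≤ ρ) :
    max (vα * ((shearUnit n h : ℤ) * lo1)) (vα * ((shearUnit n h : ℤ) * hi1 + shearUnit n h - 1)) ≤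
        vα * ((shearUnit n h : ℤ) * c) + |vα| * ((shearUnit n h : ℤ) * (ρ + 1)) ∧
      vα * ((shearUnit n h : ℤ) * c) - |vα| * ((shearUnit n h : ℤ) * (ρ + 1)) ≤
        min (vα * ((shearUnit n h : ℤ) * lo1)) (vα * ((shearUnit n h : ℤ) * hi1 + shearUnit n h - 1)) := by
  have _hm := hm
  have hU : (0 : ℤ) ≤ shearUnit n h := by positivity
  have hU1 : (1 : ℤ) ≤ shearUnit n h := by
    have : 1 ≤ shearUnit n h := by unfold shearUnit; omega
    exact_mod_cast this
  have hρ : 0 ≤ ρ := (abs_nonneg _).trans hl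
  -- `v·U·lo1 = v·U·c + v·(U·(lo1 − c))`, `|v·(U·(lo1 − c))| ≤ |v|·U·ρ`
  have k1 : |vα * ((shearUnit n h : ℤ) * (lo1 - c))| ≤ |vα| * ((shearUnit n h : ℤ) * (ρ + 1)) := by
    rw [abs_mul, abs_mul, abs_of_nonneg hU]
    exact mul_le_mul_of_nonneg_left (by nlinarith [mul_le_mul_of_nonneg_left hl hU]) (abs_nonneg _)
  have k2 : |vα * ((shearUnit n h : ℤ) * (hi1 - c) + shearUnit n h - 1)| ≤ |vα| * ((shearUnit n h : ℤ) * (ρ + 1)) := by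
    rw [abs_mul]
    refine mul_le_mul_of_nonneg_left (abs_le.2 ⟨?_, ?_⟩) (abs_nonneg _)
    · have := (abs_le.1 (show |(shearUnit n h : ℤ) * (hi1 - c)| ≤ (shearUnit n h : ℤ) * ρ by
        rw [abs_mul, abs_of_nonneg hU]; exact mul_le_mul_of_nonneg_left hh hU)).1
      nlinarith
    · have := (abs_le.1 (show |(shearUnit n h : ℤ) * (hi1 - c)| ≤ (shearUnit n h : ℤ) * ρ by
        rw [abs_mul, abs_of_nonneg hU]; exact mul_le_mul_of_nonneg_left hh hU)).2
      nlinarith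
  have e1 : vα * ((shearUnit n h : ℤ) * lo1) = vα * ((shearUnit n h : ℤ) * c) + vα * ((shearUnit n h : ℤ) * (lo1 - c)) := by ring
  have e2 : vα * ((shearUnit n h : ℤ) * hi1 + shearUnit n h - 1) =
      vα * ((shearUnit n h : ℤ) * c) + vα * ((shearUnit n h : ℤ) * (hi1 - c) + shearUnit n h - 1) := by ring
  have k1' := abs_le.1 k1
  have k2' := abs_le.1 k2
  constructor
  · exact max_le (by rw [e1]; linarith [k1'.2]) (by rw [e2]; linarith [k2'.2])
  · exact le_min (by rw [e1]; linarith [k1'.1]) (by rw [e2]; linarith [k2'.1])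

include hn hA hD hm hc₀ hsc0 in
/-- **The across reading of a drifting box** (axis `0`): `v_α·t − B ≤ lo₀`, `hi₀ ≤ v_α·t + B`, the along corners within `c ± ρ`, anchor mismatch
`|Δ·t − U·c| ≤ E`; then `−Y + 1 ≤ rdLo₀` and `rdHi₀ ≤ Y − 1` as soon as `r₀·(Δ·B + |v_α|·U·(ρ+1) + |v_α|·E) + 40Δ·n + r₀·n ≤ 40·Δ·n·Y`.
[this work] -/
theorem readAcross0_drift {lo hi : Site 2} {t B c ρ E Y : ℤ} (hlo : vα * t - B ≤ lo 0) (hhi : hi 0 ≤ vα * t + B)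
    (hl : |lo 1 - c| ≤ ρ) (hh : |hi 1 - c| ≤ ρ) (hE : |modulus n h vα vβ * t - (shearUnit n h : ℤ) * c| ≤ E)
    (hY : (P.r 0 : ℤ) * (modulus n h vα vβ * B + |vα| * ((shearUnit n h : ℤ) * (ρ + 1)) + |vα| * E) + 40 * modulus n h vα vβ * n + (P.r 0 : ℤ) * n ≤
      40 * modulus n h vα vβ * (n * Y)) :
    -Y + 1 ≤ rdLo A n h vα vβ c₀' c₁' D lo hi 0 ∧ rdHi A n h vα vβ c₀' c₁' D lo hi 0 ≤ Y - 1 := by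
  have hr0 : (0 : ℤ) ≤ P.r 0 := by positivity
  have hΔ : (0 : ℤ) < modulus n h vα vβ := hm
  obtain ⟨hmax, hmin⟩ := mixed_anchor (vα := vα) hn hm hl hh
  -- the anchor term `v·(Δ t − U c)` is bounded by `|v|·E`
  have hanch : |vα * (modulus n h vα vβ * t - (shearUnit n h : ℤ) * c)| ≤ |vα| * E := by
    rw [abs_mul]; exact mul_le_mul_of_nonneg_left hE (abs_nonneg _)
  have ha := abs_le.1 hanch
  have e : vα * (modulus n h vα vβ * t) - vα * ((shearUnit n h : ℤ) * c) = vα * (modulus n h vα vβ * t - (shearUnit n h : ℤ) * c) := by ring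
  constructor
  · refine rdLo_zero_ge hn hA hD hm hc₀ hsc0 ?_
    have h1 : modulus n h vα vβ * (vα * t - B) ≤ modulus n h vα vβ * lo 0 := mul_le_mul_of_nonneg_left hlo hΔ.le
    have hmt : modulus n h vα vβ * (vα * t) = vα * (modulus n h vα vβ * t) := by ring
    have h2 : (P.r 0 : ℤ) * (-(modulus n h vα vβ * B + |vα| * ((shearUnit n h : ℤ) * (ρ + 1)) + |vα| * E)) ≤
        (P.r 0 : ℤ) * (modulus n h vα vβ * lo 0 - max (vα * ((shearUnit n h : ℤ) * lo 1)) (vα * ((shearUnit n h : ℤ) * hi 1 + shearUnit n h - 1))) :=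
      mul_le_mul_of_nonneg_left (by rw [mul_sub] at h1; linarith [ha.1]) hr0
    have h3 : (0 : ℤ) < 40 * modulus n h vα vβ * n := by positivity
    linarith
  · refine rdHi_zero_le hn hD hm hc₀ hsc0 ?_
    have h1 : modulus n h vα vβ * hi 0 ≤ modulus n h vα vβ * (vα * t + B) := mul_le_mul_of_nonneg_left hhi hΔ.le
    have hmt : modulus n h vα vβ * (vα * t) = vα * (modulus n h vα vβ * t) := by ring
    have h2 : (P.r 0 : ℤ) * (modulus n h vα vβ * hi 0 - min (vα * ((shearUnit n h : ℤ) * lo 1)) (vα * ((shearUnit n h : ℤ) * hi 1 + shearUnit n h - 1))) ≤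
        (P.r 0 : ℤ) * (modulus n h vα vβ * B + |vα| * ((shearUnit n h : ℤ) * (ρ + 1)) + |vα| * E) :=
      mul_le_mul_of_nonneg_left (by rw [mul_add] at h1; linarith [ha.2]) hr0
    have hr1 : (1 : ℤ) ≤ P.r 0 := by exact_mod_cast P.one_le_r 0
    have h4 : (0 : ℤ) < (P.r 0 : ℤ) * n := by
      have hn0 : (0 : ℤ) < n := by exact_mod_cast hn
      nlinarith
    linarith

end Budget

end Skelφ

end Transplant

end Summit.CriticalPhenomena.PercolationContinuityZ3.Theorems

end
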